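import Summits.QuantumFields.BalabanUV.Beta.GAN24.ExponentialChartBaseHessianDiag

/-!
# `BalabanUV.Beta.GAN24.ExponentialChartBasePolarisation` — binder row G-an2-4 ∕ (CONV-C), route R7 «TWO CURRENCIES», PART 275: THE ONE-LOOP HESSIAN AT A NONZERO SMALL ABELIAN
# BACKGROUND IS HALF THE POLARISATION OF THE ONE-PARAMETER SECOND DERIVATIVES — AND SO ARE ITS LIMIT KERNELS AND β-TYPE NUMBERS (PART 255 at the base point `U₀ = e^{iηA₀}`).
# PART 270 (bilinear + symmetric under the invertibility) and PART 274's `hessianAt_diag_shift` (the diagonal IS `∂²_s|₀` along the chart, no hypothesis) give, at every volume,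
# **`H_{U₀}(A, B) + H_{U₀}(A, B) = ∂²_s|₀[c_k(e^{iη(A₀ + s(A+B))})⁻¹] − ∂²_s|₀[c_k(e^{iη(A₀ + sA)})⁻¹] − ∂²_s|₀[c_k(e^{iη(A₀ + sB)})⁻¹]`** and PART 255's display
# `H_{U₀}(A, B) = ½(⋯)`; by uniqueness of limits, ANY infinite-volume limit kernels `Π` of PART 269's family of `(A, B)` and `Π⁽²⁾(A + B), Π⁽²⁾(A), Π⁽²⁾(B)` of leaf-01's `N = 2`
# families satisfy **`2·Π = Π⁽²⁾(A + B) − Π⁽²⁾(A) − Π⁽²⁾(B)`** pointwise on `ℤ^d`; under (UD) `δ > 0` for `Π, Π⁽²⁾(A), Π⁽²⁾(B)` the (1.22) level numbers obey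
# `b⁽²⁾_k(A + B) = 2·b_k(A, B) + b⁽²⁾_k(A) + b⁽²⁾_k(B)`, and under the END's rates so do the limit numbers — i.e. **the off-diagonal β-type numbers at `U₀` are determined by the
# one-parameter tower's numbers alone**; §4 assembles it over PART 269's END and leaf-01's `N = 2` END (×3), displaying only `(α, β)` + EL₁ of `A, B` and the base constants ∕ EL₁
# on the disc (unit b2b-balaban-gan24-p3, gen 67; v1; generator `HOME/b2b-balaban-gan24-p3/gen67/records/gen/gen275.py`)

NOT IN PRINT; OUR PROOF ([folklore] bookkeeping BY NAME over PART 270 (`hessianAt_symm ∕ _add_left ∕ _add_right`), PART 274 (`hessianAt_diag_shift`), PART 271 §0, PART 269, leaf-01's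
`ExponentialChartBaseCovariantTaylorLine.conv_iteratedDeriv_invCov_expChartAt_of_tendsto`, PART 259 §1 and Literature `LimitRate` (`UniformDecay.summable`,
`tendsto_of_abs_sub_le_geometric`); Mathlib's `tendsto_nhds_unique`, `two_smul`, `smul_smul`; [Balaban1985BackgroundPropagators] (3.3) p. 390 and [Balaban1987RG1] (1.20)–(1.22)
p. 264 LOCATE the shapes; nothing printed is a hypothesis).
HONEST FRAMING (cell contract, verbatim): «discharging `BetaPertH` makes Bałaban's UV stability UNCONDITIONAL — a real constructive-QFT result; it is NOT the
continuum limit and NOT the Clay problem.»  HONEST DEPENDENCY (verbatim): «continuum YM on T⁴ ⇐ BetaPertH ∧ nine spine estimates (0/9 proved); BetaPertH ⇐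
(D1) ∧ (D4) ∧ CAP+tail; G-an2-4 gates asym, D1 and NE2/3/4.»

WHAT THIS FILE PROVES (0 sorry, 0 `def`; REAL `A₀, A, B`):
* §1 (every volume `M`, level `k`, invertibility displayed): **`hessianAt_add_self_eq_polarisation`**, **`hessianAt_eq_half_polarisation`** (PART 255's display at `U₀`).
* §2 (even cubic volumes, `h0 ∕ hc0 : ∀ t`; ANY limit kernels): **`hessianAtKernel_polarisation`** — `2·Π(A, B) = Π⁽²⁾(A + B) − Π⁽²⁾(A) − Π⁽²⁾(B)` pointwise.
* §3 **`hessianAtMoments_polarisation`** — level numbers under (UD) `δ > 0`, limit numbers under the END's rates.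
* §4 **`exists_hessianAtMoments_polarisation_of_tendsto`** — over PART 269's END and leaf-01's `N = 2` END, displaying only `(α, β)` + EL₁ of `A, B` and the base data on the disc.
WHAT IT DOES NOT DO: colour; Bałaban's `−∂P∂*` ∕ `aQ(U)*Q(U)` parts; base points off the disc.  SUPPLIER work; NEVER «G-an2-4 closed»; NOT (CONV-C), NOT D1, NOT `BetaPertH`, NOT
continuum, NOT Clay.  Records: `HOME/b2b-balaban-gan24-p3/gen67/README.md`.
-/

noncomputable section

open scoped BigOperators ComplexConjugate Matrix Matrix.Norms.L2Operator
open Filter Topology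

namespace Summit.QuantumFields.BalabanUV.Beta.GAN24.ExponentialChartBasePolarisation

open Literature.MathematicalPhysics.QuantumFieldTheory.Balaban1983to89
open Literature.MathematicalPhysics.QuantumFieldTheory.Balaban1983to89.B5Prop11Plancherel (Tor fine Cst)
open Literature.MathematicalPhysics.QuantumFieldTheory.Balaban1983to89.B5G183RateUnitTower (lev)
open Literature.MathematicalPhysics.QuantumFieldTheory.Balaban1983to89.Beta (Site IsInfiniteVolumeLimit)
open Literature.MathematicalPhysics.QuantumFieldTheory.Balaban1983to89.Beta.FreeLegDictionary (cubic)
open Literature.MathematicalPhysics.QuantumFieldTheory.Balaban1983to89.Beta.BlockKernelVolumeSockets (evenPeriod)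
open Literature.MathematicalPhysics.QuantumFieldTheory.Balaban1983to89.Beta.VectorTails (castT)
open Literature.MathematicalPhysics.QuantumFieldTheory.Balaban1983to89.Beta.LimitRate (UniformDecay limKernelOf tendsto_of_abs_sub_le_geometric)
open Summit.QuantumFields.BalabanUV.T4Continuum
open Summit.QuantumFields.BalabanUV.T4Continuum.CovariantAveragingTower (avgTow)
open Summit.QuantumFields.BalabanUV.T4Continuum.BalabanAveragedTowerUnit (idx QBlev)
open Summit.QuantumFields.BalabanUV.T4Continuum.BalabanAveragedCoerciveTower (unitIdx)
open Summit.QuantumFields.BalabanUV.T4Continuum.BalabanAveragedCoercive (gammaB)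
open Summit.QuantumFields.BalabanUV.T4Continuum.KingPairingPlantedLaw (calDalev)
open Summit.QuantumFields.BalabanUV.T4Continuum.FirstOrderBackgroundModel (LipschitzBackground)
open Summit.QuantumFields.BalabanUV.T4Continuum.PerturbationAlgebra (BoundedBackground)
open Summit.QuantumFields.BalabanUV.T4Continuum.AbelianCovariantLaplacian (covPert connV zT)
open Summit.QuantumFields.BalabanUV.T4Continuum.CTConjugatedHbd (G2)
open Summit.QuantumFields.BalabanUV.T4Continuum.DirichletRegionTower (gamD)
open Summit.QuantumFields.BalabanUV.T4Continuum.ScalarAveragedPropagator (gammaPs)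
open Summit.QuantumFields.BalabanUV.T4Continuum.ScalarAveragedCompression (sigma0)
open Summit.QuantumFields.BalabanUV.T4Continuum.CTScalarGreen (Jfree)
open Summit.QuantumFields.BalabanUV.T4Continuum.CTGaugeTerm (deltaK)
open Summit.QuantumFields.BalabanUV.T4Continuum.CTVectorPropagator (JA)
open Summit.QuantumFields.BalabanUV.Beta.GAN24.ExponentialChartMixedBackgrounds (lipschitzBackground_add lipschitzBackground_mono)
open Summit.QuantumFields.BalabanUV.Beta.GAN24.ExponentialChartHessianMoments (secondMoment_add_of_summable secondMoment_const_mul)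
open Summit.QuantumFields.BalabanUV.Beta.GAN24.ExponentialChartBaseCovariantTaylorEnd (conv_deriv_deriv_invCov_expChartAt₂_of_tendsto)
open Summit.QuantumFields.BalabanUV.Beta.GAN24.ExponentialChartBaseCovariantTaylorLine (conv_iteratedDeriv_invCov_expChartAt_of_tendsto)
open Summit.QuantumFields.BalabanUV.Beta.GAN24.ExponentialChartBaseHessianForm (hessianAt_symm hessianAt_add_left hessianAt_add_right)
open Summit.QuantumFields.BalabanUV.Beta.GAN24.ExponentialChartBaseHessianKernels (isUnit_det_calDalev_add_covPert_of_disc isUnit_det_avgTow_pertInv_of_disc)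
open Summit.QuantumFields.BalabanUV.Beta.GAN24.ExponentialChartBaseHessianDiag (hessianAt_diag_shift)

variable {d : ℕ} (L : ℕ) [NeZero L]

/-! ## §1 The Hessian at `U₀` is half the polarisation of the one-parameter second derivatives (every volume, invertibility displayed) -/

section Single

variable (M : Fin d → ℕ) [hM : ∀ μ, NeZero (M μ)] (a : ℝ) (ha : 0 < a)

/-- **`hessianAt_add_self_eq_polarisation`** [our proof]: for every volume, every level `k`, REAL `A₀, A, B`, under the displayed invertibility of `Δ_a + (Δ^{U₀} − Δ^1)` and `c_k(U₀)`:
`H_{U₀}(A, B) + H_{U₀}(A, B) = ∂²_s|₀[c_k(e^{iη(A₀ + s(A+B))})⁻¹] − ∂²_s|₀[c_k(e^{iη(A₀ + sA)})⁻¹] − ∂²_s|₀[c_k(e^{iη(A₀ + sB)})⁻¹]` — PART 274's `hessianAt_diag_shift` turns the three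
second derivatives into `H(A+B, A+B)`, `H(A, A)`, `H(B, B)`, PART 270 expands `H(A+B, A+B)` bilinearly and symmetrises. -/
theorem hessianAt_add_self_eq_polarisation (A₀ A B : (k : ℕ) → Fin d → (idx L M k → ℝ)) (k : ℕ)
    (h0 : IsUnit (calDalev L M a ha k + covPert L M (fun k'' ν' (x' : idx L M k'') => Complex.exp (Complex.I * (A₀ k'' ν' x' : ℂ) / ((lev L k'' : ℕ) : ℂ))) k).det)
    (hc0 : IsUnit (avgTow (QBlev L M) ((L : ℝ) ^ d) (fun k' => (calDalev L M a ha k' + covPert L M (fun k'' ν' (x' : idx L M k'') => Complex.exp (Complex.I * (A₀ k'' ν' x' : ℂ) / ((lev L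
          k'' : ℕ) : ℂ))) k')⁻¹) k).det) :
    deriv (fun r : ℝ => deriv (fun s : ℝ => (avgTow (QBlev L M) ((L : ℝ) ^ d)
        (fun k' => (calDalev L M a ha k' + covPert L M (fun k'' ν' (x' : idx L M k'') => Complex.exp (Complex.I * (A₀ k'' ν' x' : ℂ) / ((lev L k'' : ℕ) : ℂ) + (Complex.I * (A k'' ν' x' : ℂ)
              / ((lev L k'' : ℕ) : ℂ)) * ((s : ℝ) : ℂ) + (Complex.I * (B k'' ν' x' : ℂ) / ((lev L k'' : ℕ) : ℂ)) * ((r : ℝ) : ℂ))) k')⁻¹) k)⁻¹) 0) 0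
      + deriv (fun r : ℝ => deriv (fun s : ℝ => (avgTow (QBlev L M) ((L : ℝ) ^ d)
        (fun k' => (calDalev L M a ha k' + covPert L M (fun k'' ν' (x' : idx L M k'') => Complex.exp (Complex.I * (A₀ k'' ν' x' : ℂ) / ((lev L k'' : ℕ) : ℂ) + (Complex.I * (A k'' ν' x' : ℂ)
              / ((lev L k'' : ℕ) : ℂ)) * ((s : ℝ) : ℂ) + (Complex.I * (B k'' ν' x' : ℂ) / ((lev L k'' : ℕ) : ℂ)) * ((r : ℝ) : ℂ))) k')⁻¹) k)⁻¹) 0) 0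
      = iteratedDeriv 2 (fun s : ℝ => (avgTow (QBlev L M) ((L : ℝ) ^ d)
          (fun k' => (calDalev L M a ha k' + covPert L M (fun k'' ν' (x' : idx L M k'') => Complex.exp (Complex.I * (A₀ k'' ν' x' : ℂ) / ((lev L k'' : ℕ) : ℂ) + (Complex.I *
                  ((A k'' ν' x' + B k'' ν' x' : ℝ) : ℂ) / ((lev L k'' : ℕ) : ℂ)) * ((s : ℝ) : ℂ))) k')⁻¹) k)⁻¹) 0
        - iteratedDeriv 2 (fun s : ℝ => (avgTow (QBlev L M) ((L : ℝ) ^ d)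
          (fun k' => (calDalev L M a ha k' + covPert L M (fun k'' ν' (x' : idx L M k'') => Complex.exp (Complex.I * (A₀ k'' ν' x' : ℂ) / ((lev L k'' : ℕ) : ℂ) + (Complex.I *
                  (A k'' ν' x' : ℂ) / ((lev L k'' : ℕ) : ℂ)) * ((s : ℝ) : ℂ))) k')⁻¹) k)⁻¹) 0
        - iteratedDeriv 2 (fun s : ℝ => (avgTow (QBlev L M) ((L : ℝ) ^ d)
          (fun k' => (calDalev L M a ha k' + covPert L M (fun k'' ν' (x' : idx L M k'') => Complex.exp (Complex.I * (A₀ k'' ν' x' : ℂ) / ((lev L k'' : ℕ) : ℂ) + (Complex.I *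
                  (B k'' ν' x' : ℂ) / ((lev L k'' : ℕ) : ℂ)) * ((s : ℝ) : ℂ))) k')⁻¹) k)⁻¹) 0 := by
  rw [← hessianAt_diag_shift L M a ha A₀ (fun k ν x => A k ν x + B k ν x) k, ← hessianAt_diag_shift L M a ha A₀ A k, ← hessianAt_diag_shift L M a ha A₀ B k,
    hessianAt_add_left L M a ha A₀ A B (fun k ν x => A k ν x + B k ν x) k h0 hc0, hessianAt_add_right L M a ha A₀ A A B k h0 hc0, hessianAt_add_right L M a ha A₀ B A B k h0 hc0,
    hessianAt_symm L M a ha A₀ B A k h0 hc0]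
  abel

/-- **`hessianAt_eq_half_polarisation`** — PART 255's display at `U₀`: `H_{U₀}(A, B) = ½(∂²_s|₀ along A+B − ∂²_s|₀ along A − ∂²_s|₀ along B)`, under the displayed invertibility.
[our proof] -/
theorem hessianAt_eq_half_polarisation (A₀ A B : (k : ℕ) → Fin d → (idx L M k → ℝ)) (k : ℕ)
    (h0 : IsUnit (calDalev L M a ha k + covPert L M (fun k'' ν' (x' : idx L M k'') => Complex.exp (Complex.I * (A₀ k'' ν' x' : ℂ) / ((lev L k'' : ℕ) : ℂ))) k).det)
    (hc0 : IsUnit (avgTow (QBlev L M) ((L : ℝ) ^ d) (fun k' => (calDalev L M a ha k' + covPert L M (fun k'' ν' (x' : idx L M k'') => Complex.exp (Complex.I * (A₀ k'' ν' x' : ℂ) / ((lev L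
          k'' : ℕ) : ℂ))) k')⁻¹) k).det) :
    deriv (fun r : ℝ => deriv (fun s : ℝ => (avgTow (QBlev L M) ((L : ℝ) ^ d)
        (fun k' => (calDalev L M a ha k' + covPert L M (fun k'' ν' (x' : idx L M k'') => Complex.exp (Complex.I * (A₀ k'' ν' x' : ℂ) / ((lev L k'' : ℕ) : ℂ) + (Complex.I * (A k'' ν' x' : ℂ)
              / ((lev L k'' : ℕ) : ℂ)) * ((s : ℝ) : ℂ) + (Complex.I * (B k'' ν' x' : ℂ) / ((lev L k'' : ℕ) : ℂ)) * ((r : ℝ) : ℂ))) k')⁻¹) k)⁻¹) 0) 0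
      = (1 / 2 : ℂ) • (iteratedDeriv 2 (fun s : ℝ => (avgTow (QBlev L M) ((L : ℝ) ^ d)
          (fun k' => (calDalev L M a ha k' + covPert L M (fun k'' ν' (x' : idx L M k'') => Complex.exp (Complex.I * (A₀ k'' ν' x' : ℂ) / ((lev L k'' : ℕ) : ℂ) + (Complex.I *
                  ((A k'' ν' x' + B k'' ν' x' : ℝ) : ℂ) / ((lev L k'' : ℕ) : ℂ)) * ((s : ℝ) : ℂ))) k')⁻¹) k)⁻¹) 0
        - iteratedDeriv 2 (fun s : ℝ => (avgTow (QBlev L M) ((L : ℝ) ^ d)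
          (fun k' => (calDalev L M a ha k' + covPert L M (fun k'' ν' (x' : idx L M k'') => Complex.exp (Complex.I * (A₀ k'' ν' x' : ℂ) / ((lev L k'' : ℕ) : ℂ) + (Complex.I *
                  (A k'' ν' x' : ℂ) / ((lev L k'' : ℕ) : ℂ)) * ((s : ℝ) : ℂ))) k')⁻¹) k)⁻¹) 0
        - iteratedDeriv 2 (fun s : ℝ => (avgTow (QBlev L M) ((L : ℝ) ^ d)
          (fun k' => (calDalev L M a ha k' + covPert L M (fun k'' ν' (x' : idx L M k'') => Complex.exp (Complex.I * (A₀ k'' ν' x' : ℂ) / ((lev L k'' : ℕ) : ℂ) + (Complex.I *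
                  (B k'' ν' x' : ℂ) / ((lev L k'' : ℕ) : ℂ)) * ((s : ℝ) : ℂ))) k')⁻¹) k)⁻¹) 0) := by
  rw [← hessianAt_add_self_eq_polarisation L M a ha A₀ A B k h0 hc0, ← two_smul ℂ, smul_smul]
  norm_num

end Single

/-! ## §2 The limit kernels: `2·Π(A, B) = Π⁽²⁾(A + B) − Π⁽²⁾(A) − Π⁽²⁾(B)` (uniqueness of limits) -/

section Kernels

variable (a : ℝ) (ha : 0 < a)

/-- **`hessianAtKernel_polarisation`** [our proof]: for ANY infinite-volume limit kernels `Π` of PART 269's family of `(A, B)` at `U₀` (level `k`) and `Π⁽²⁾_{A+B}, Π⁽²⁾_A, Π⁽²⁾_B` of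
leaf-01's `N = 2` families of `A + B`, `A`, `B`: `2·Π = Π⁽²⁾_{A+B} − Π⁽²⁾_A − Π⁽²⁾_B` pointwise on `ℤ^d` (§1 volume by volume, read at the entries; `tendsto_nhds_unique`); the invertibility
at the base displayed for every volume (PART 271 §0 on the disc). -/
theorem hessianAtKernel_polarisation {A₀ A B : (t : ℕ) → (k : ℕ) → Fin d → (idx L (cubic d (evenPeriod t)) k → ℝ)} (k : ℕ)
    (h0 : ∀ t, IsUnit (calDalev L (cubic d (evenPeriod t)) a ha k + covPert L (cubic d (evenPeriod t)) (fun k'' ν' (x' : idx L (cubic d (evenPeriod t)) k'') => Complex.exp (Complex.I * ((A₀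
          t) k'' ν' x' : ℂ) / ((lev L k'' : ℕ) : ℂ))) k).det)
    (hc0 : ∀ t, IsUnit (avgTow (QBlev L (cubic d (evenPeriod t))) ((L : ℝ) ^ d) (fun k' => (calDalev L (cubic d (evenPeriod t)) a ha k' + covPert L (cubic d (evenPeriod t)) (fun k'' ν' (x'
          : idx L (cubic d (evenPeriod t)) k'') => Complex.exp (Complex.I * ((A₀ t) k'' ν' x' : ℂ) / ((lev L k'' : ℕ) : ℂ))) k')⁻¹) k).det) {P QAB QA QB : B12Beta.Kernel d}
    (h : IsInfiniteVolumeLimit evenPeriod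
      (fun t μ' ν' (z : Site d (evenPeriod t)) =>
          ((deriv (fun r : ℝ => deriv (fun s : ℝ => (avgTow (QBlev L (cubic d (evenPeriod t))) ((L : ℝ) ^ d)
          (fun k' => (calDalev L (cubic d (evenPeriod t)) a ha k' + covPert L (cubic d (evenPeriod t)) (fun k'' ν' (x' : idx L (cubic d (evenPeriod t)) k'') => Complex.exp
                (Complex.I * ((A₀ t) k'' ν' x' : ℂ) / ((lev L k'' : ℕ) : ℂ) + (Complex.I * ((A t) k'' ν' x' : ℂ) / ((lev L k'' : ℕ) : ℂ)) * ((s : ℝ) : ℂ) + (Complex.I * ((B t) k'' ν' x' :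
                      ℂ) / ((lev L k'' : ℕ) : ℂ)) * ((r : ℝ) :
                ℂ))) k')⁻¹) k)⁻¹) 0) 0)
            ((unitIdx L (cubic d (evenPeriod t))).symm (z, μ')) ((unitIdx L (cubic d (evenPeriod t))).symm (0, ν'))).re) P)
    (hAB : IsInfiniteVolumeLimit evenPeriod
      (fun t μ' ν' (z : Site d (evenPeriod t)) =>
          ((iteratedDeriv 2 (fun s : ℝ => (avgTow (QBlev L (cubic d (evenPeriod t))) ((L : ℝ) ^ d)
          (fun k' => (calDalev L (cubic d (evenPeriod t)) a ha k' + covPert L (cubic d (evenPeriod t)) (fun k'' ν' (x' : idx L (cubic d (evenPeriod t)) k'') => Complex.exp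
                (Complex.I * ((A₀ t) k'' ν' x' : ℂ) / ((lev L k'' : ℕ) : ℂ) + (Complex.I * ((A t k'' ν' x' + B t k'' ν' x' : ℝ) : ℂ) / ((lev L k'' : ℕ) : ℂ)) * ((s : ℝ) : ℂ))) k')⁻¹) k)⁻¹)
                      0)
            ((unitIdx L (cubic d (evenPeriod t))).symm (z, μ')) ((unitIdx L (cubic d (evenPeriod t))).symm (0, ν'))).re) QAB)
    (hA : IsInfiniteVolumeLimit evenPeriod
      (fun t μ' ν' (z : Site d (evenPeriod t)) =>
          ((iteratedDeriv 2 (fun s : ℝ => (avgTow (QBlev L (cubic d (evenPeriod t))) ((L : ℝ) ^ d)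
          (fun k' => (calDalev L (cubic d (evenPeriod t)) a ha k' + covPert L (cubic d (evenPeriod t)) (fun k'' ν' (x' : idx L (cubic d (evenPeriod t)) k'') => Complex.exp
                (Complex.I * ((A₀ t) k'' ν' x' : ℂ) / ((lev L k'' : ℕ) : ℂ) + (Complex.I * ((A t) k'' ν' x' : ℂ) / ((lev L k'' : ℕ) : ℂ)) * ((s : ℝ) : ℂ))) k')⁻¹) k)⁻¹) 0)
            ((unitIdx L (cubic d (evenPeriod t))).symm (z, μ')) ((unitIdx L (cubic d (evenPeriod t))).symm (0, ν'))).re) QA)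
    (hB : IsInfiniteVolumeLimit evenPeriod
      (fun t μ' ν' (z : Site d (evenPeriod t)) =>
          ((iteratedDeriv 2 (fun s : ℝ => (avgTow (QBlev L (cubic d (evenPeriod t))) ((L : ℝ) ^ d)
          (fun k' => (calDalev L (cubic d (evenPeriod t)) a ha k' + covPert L (cubic d (evenPeriod t)) (fun k'' ν' (x' : idx L (cubic d (evenPeriod t)) k'') => Complex.exp
                (Complex.I * ((A₀ t) k'' ν' x' : ℂ) / ((lev L k'' : ℕ) : ℂ) + (Complex.I * ((B t) k'' ν' x' : ℂ) / ((lev L k'' : ℕ) : ℂ)) * ((s : ℝ) : ℂ))) k')⁻¹) k)⁻¹) 0)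
            ((unitIdx L (cubic d (evenPeriod t))).symm (z, μ')) ((unitIdx L (cubic d (evenPeriod t))).symm (0, ν'))).re) QB) :
    ∀ μ ν (x : Fin d → ℤ), 2 * P μ ν x = QAB μ ν x - QA μ ν x - QB μ ν x := by
  intro μ ν x
  have e : ∀ (t : ℕ) i j,
      ((deriv (fun r : ℝ => deriv (fun s : ℝ => (avgTow (QBlev L (cubic d (evenPeriod t))) ((L : ℝ) ^ d)
          (fun k' => (calDalev L (cubic d (evenPeriod t)) a ha k' + covPert L (cubic d (evenPeriod t)) (fun k'' ν' (x' : idx L (cubic d (evenPeriod t)) k'') => Complex.exp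
                (Complex.I * ((A₀ t) k'' ν' x' : ℂ) / ((lev L k'' : ℕ) : ℂ) + (Complex.I * ((A t) k'' ν' x' : ℂ) / ((lev L k'' : ℕ) : ℂ)) * ((s : ℝ) : ℂ) + (Complex.I * ((B t) k'' ν' x' :
                      ℂ) / ((lev L k'' : ℕ) : ℂ)) * ((r : ℝ) :
                ℂ))) k')⁻¹) k)⁻¹) 0) 0) i j).re
        + ((deriv (fun r : ℝ => deriv (fun s : ℝ => (avgTow (QBlev L (cubic d (evenPeriod t))) ((L : ℝ) ^ d)
          (fun k' => (calDalev L (cubic d (evenPeriod t)) a ha k' + covPert L (cubic d (evenPeriod t)) (fun k'' ν' (x' : idx L (cubic d (evenPeriod t)) k'') => Complex.exp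
                (Complex.I * ((A₀ t) k'' ν' x' : ℂ) / ((lev L k'' : ℕ) : ℂ) + (Complex.I * ((A t) k'' ν' x' : ℂ) / ((lev L k'' : ℕ) : ℂ)) * ((s : ℝ) : ℂ) + (Complex.I * ((B t) k'' ν' x' :
                      ℂ) / ((lev L k'' : ℕ) : ℂ)) * ((r : ℝ) :
                ℂ))) k')⁻¹) k)⁻¹) 0) 0) i j).re
      = ((iteratedDeriv 2 (fun s : ℝ => (avgTow (QBlev L (cubic d (evenPeriod t))) ((L : ℝ) ^ d)
          (fun k' => (calDalev L (cubic d (evenPeriod t)) a ha k' + covPert L (cubic d (evenPeriod t)) (fun k'' ν' (x' : idx L (cubic d (evenPeriod t)) k'') => Complex.exp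
                (Complex.I * ((A₀ t) k'' ν' x' : ℂ) / ((lev L k'' : ℕ) : ℂ) + (Complex.I * ((A t k'' ν' x' + B t k'' ν' x' : ℝ) : ℂ) / ((lev L k'' : ℕ) : ℂ)) * ((s : ℝ) : ℂ))) k')⁻¹) k)⁻¹)
                      0) i j).re
        - ((iteratedDeriv 2 (fun s : ℝ => (avgTow (QBlev L (cubic d (evenPeriod t))) ((L : ℝ) ^ d)
          (fun k' => (calDalev L (cubic d (evenPeriod t)) a ha k' + covPert L (cubic d (evenPeriod t)) (fun k'' ν' (x' : idx L (cubic d (evenPeriod t)) k'') => Complex.exp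
                (Complex.I * ((A₀ t) k'' ν' x' : ℂ) / ((lev L k'' : ℕ) : ℂ) + (Complex.I * ((A t) k'' ν' x' : ℂ) / ((lev L k'' : ℕ) : ℂ)) * ((s : ℝ) : ℂ))) k')⁻¹) k)⁻¹) 0) i j).re
        - ((iteratedDeriv 2 (fun s : ℝ => (avgTow (QBlev L (cubic d (evenPeriod t))) ((L : ℝ) ^ d)
          (fun k' => (calDalev L (cubic d (evenPeriod t)) a ha k' + covPert L (cubic d (evenPeriod t)) (fun k'' ν' (x' : idx L (cubic d (evenPeriod t)) k'') => Complex.exp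
                (Complex.I * ((A₀ t) k'' ν' x' : ℂ) / ((lev L k'' : ℕ) : ℂ) + (Complex.I * ((B t) k'' ν' x' : ℂ) / ((lev L k'' : ℕ) : ℂ)) * ((s : ℝ) : ℂ))) k')⁻¹) k)⁻¹) 0) i j).re := fun t
                      i j => by
    have hv := congrArg (fun N => (N i j).re)
      (hessianAt_add_self_eq_polarisation L (cubic d (evenPeriod t)) a ha (A₀ t) (A t) (B t) k (h0 t) (hc0 t))
    simpa only [Matrix.add_apply, Matrix.sub_apply, Complex.add_re, Complex.sub_re] using hv
  refine tendsto_nhds_unique ((h μ ν x).const_mul 2) ((((hAB μ ν x).sub (hA μ ν x)).sub (hB μ ν x)).congr fun t => ?_)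
  dsimp only
  rw [two_mul]
  exact (e t _ _).symm

/-! ## §3 The β-type numbers: `b⁽²⁾(A + B) = 2·b(A, B) + b⁽²⁾(A) + b⁽²⁾(B)` — level numbers under (UD), limit numbers under the END's rates -/

/-- **`hessianAtMoments_polarisation`** [our proof]: for ANY infinite-volume limit kernels `Π` (PART 269's family of `(A, B)` at `U₀`) and `Π⁽²⁾_{A+B}, Π⁽²⁾_A, Π⁽²⁾_B` (leaf-01's `N = 2`
families), every level, and a pair `(μ, ν)`: (i) under (UD) `UniformDecay` with `δ > 0` for `Π, Π⁽²⁾_A, Π⁽²⁾_B` (absolute convergence of (1.22)), the level numbers satisfy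
`b⁽²⁾_k(A + B) = 2·b_k(A, B) + b⁽²⁾_k(A) + b⁽²⁾_k(B)`; (ii) if moreover the four families have the END's rate `|b_k − b_∞| ≤ c·θ^k` (`0 ≤ θ < 1`), the limit numbers satisfy the same
identity (§2's kernel identity; PART 259 §1's `secondMoment_add_of_summable ∕ _const_mul`; `tendsto_of_abs_sub_le_geometric`, `tendsto_nhds_unique`). -/
theorem hessianAtMoments_polarisation {A₀ A B : (t : ℕ) → (k : ℕ) → Fin d → (idx L (cubic d (evenPeriod t)) k → ℝ)}
    (h0 : ∀ t k, IsUnit (calDalev L (cubic d (evenPeriod t)) a ha k + covPert L (cubic d (evenPeriod t)) (fun k'' ν' (x' : idx L (cubic d (evenPeriod t)) k'') => Complex.exp (Complex.I *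
          ((A₀ t) k'' ν' x' : ℂ) / ((lev L k'' : ℕ) : ℂ))) k).det)
    (hc0 : ∀ t k, IsUnit (avgTow (QBlev L (cubic d (evenPeriod t))) ((L : ℝ) ^ d) (fun k' => (calDalev L (cubic d (evenPeriod t)) a ha k' + covPert L (cubic d (evenPeriod t)) (fun k'' ν'
          (x' : idx L (cubic d (evenPeriod t)) k'') => Complex.exp (Complex.I * ((A₀ t) k'' ν' x' : ℂ) / ((lev L k'' : ℕ) : ℂ))) k')⁻¹) k).det) {P QAB QA QB : ℕ → B12Beta.Kernel d}
    (h : ∀ k, IsInfiniteVolumeLimit evenPeriod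
      (fun t μ' ν' (z : Site d (evenPeriod t)) =>
          ((deriv (fun r : ℝ => deriv (fun s : ℝ => (avgTow (QBlev L (cubic d (evenPeriod t))) ((L : ℝ) ^ d)
          (fun k' => (calDalev L (cubic d (evenPeriod t)) a ha k' + covPert L (cubic d (evenPeriod t)) (fun k'' ν' (x' : idx L (cubic d (evenPeriod t)) k'') => Complex.exp
                (Complex.I * ((A₀ t) k'' ν' x' : ℂ) / ((lev L k'' : ℕ) : ℂ) + (Complex.I * ((A t) k'' ν' x' : ℂ) / ((lev L k'' : ℕ) : ℂ)) * ((s : ℝ) : ℂ) + (Complex.I * ((B t) k'' ν' x' :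
                      ℂ) / ((lev L k'' : ℕ) : ℂ)) * ((r : ℝ) :
                ℂ))) k')⁻¹) k)⁻¹) 0) 0)
            ((unitIdx L (cubic d (evenPeriod t))).symm (z, μ')) ((unitIdx L (cubic d (evenPeriod t))).symm (0, ν'))).re) (P k))
    (hAB : ∀ k, IsInfiniteVolumeLimit evenPeriod
      (fun t μ' ν' (z : Site d (evenPeriod t)) =>
          ((iteratedDeriv 2 (fun s : ℝ => (avgTow (QBlev L (cubic d (evenPeriod t))) ((L : ℝ) ^ d)
          (fun k' => (calDalev L (cubic d (evenPeriod t)) a ha k' + covPert L (cubic d (evenPeriod t)) (fun k'' ν' (x' : idx L (cubic d (evenPeriod t)) k'') => Complex.exp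
                (Complex.I * ((A₀ t) k'' ν' x' : ℂ) / ((lev L k'' : ℕ) : ℂ) + (Complex.I * ((A t k'' ν' x' + B t k'' ν' x' : ℝ) : ℂ) / ((lev L k'' : ℕ) : ℂ)) * ((s : ℝ) : ℂ))) k')⁻¹) k)⁻¹)
                      0)
            ((unitIdx L (cubic d (evenPeriod t))).symm (z, μ')) ((unitIdx L (cubic d (evenPeriod t))).symm (0, ν'))).re) (QAB k))
    (hA : ∀ k, IsInfiniteVolumeLimit evenPeriod
      (fun t μ' ν' (z : Site d (evenPeriod t)) =>
          ((iteratedDeriv 2 (fun s : ℝ => (avgTow (QBlev L (cubic d (evenPeriod t))) ((L : ℝ) ^ d)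
          (fun k' => (calDalev L (cubic d (evenPeriod t)) a ha k' + covPert L (cubic d (evenPeriod t)) (fun k'' ν' (x' : idx L (cubic d (evenPeriod t)) k'') => Complex.exp
                (Complex.I * ((A₀ t) k'' ν' x' : ℂ) / ((lev L k'' : ℕ) : ℂ) + (Complex.I * ((A t) k'' ν' x' : ℂ) / ((lev L k'' : ℕ) : ℂ)) * ((s : ℝ) : ℂ))) k')⁻¹) k)⁻¹) 0)
            ((unitIdx L (cubic d (evenPeriod t))).symm (z, μ')) ((unitIdx L (cubic d (evenPeriod t))).symm (0, ν'))).re) (QA k))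
    (hB : ∀ k, IsInfiniteVolumeLimit evenPeriod
      (fun t μ' ν' (z : Site d (evenPeriod t)) =>
          ((iteratedDeriv 2 (fun s : ℝ => (avgTow (QBlev L (cubic d (evenPeriod t))) ((L : ℝ) ^ d)
          (fun k' => (calDalev L (cubic d (evenPeriod t)) a ha k' + covPert L (cubic d (evenPeriod t)) (fun k'' ν' (x' : idx L (cubic d (evenPeriod t)) k'') => Complex.exp
                (Complex.I * ((A₀ t) k'' ν' x' : ℂ) / ((lev L k'' : ℕ) : ℂ) + (Complex.I * ((B t) k'' ν' x' : ℂ) / ((lev L k'' : ℕ) : ℂ)) * ((s : ℝ) : ℂ))) k')⁻¹) k)⁻¹) 0)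
            ((unitIdx L (cubic d (evenPeriod t))).symm (z, μ')) ((unitIdx L (cubic d (evenPeriod t))).symm (0, ν'))).re) (QB k))
    {μ ν : Fin d} {CP δP CA δA CB δB : ℝ} (hUP : UniformDecay P μ ν CP δP) (hδP : 0 < δP) (hUA : UniformDecay QA μ ν CA δA) (hδA : 0 < δA)
    (hUB : UniformDecay QB μ ν CB δB) (hδB : 0 < δB) :
    (∀ k, B12Beta.secondMoment (QAB k) μ ν = 2 * B12Beta.secondMoment (P k) μ ν + B12Beta.secondMoment (QA k) μ ν + B12Beta.secondMoment (QB k) μ ν) ∧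
      ∀ {cP cA cB cAB θ : ℝ}, 0 ≤ θ → θ < 1 →
        (∀ k, |B12Beta.secondMoment (P k) μ ν - B12Beta.secondMoment (limKernelOf P) μ ν| ≤ cP * θ ^ k) →
        (∀ k, |B12Beta.secondMoment (QA k) μ ν - B12Beta.secondMoment (limKernelOf QA) μ ν| ≤ cA * θ ^ k) →
        (∀ k, |B12Beta.secondMoment (QB k) μ ν - B12Beta.secondMoment (limKernelOf QB) μ ν| ≤ cB * θ ^ k) →
        (∀ k, |B12Beta.secondMoment (QAB k) μ ν - B12Beta.secondMoment (limKernelOf QAB) μ ν| ≤ cAB * θ ^ k) →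
          B12Beta.secondMoment (limKernelOf QAB) μ ν
            = 2 * B12Beta.secondMoment (limKernelOf P) μ ν + B12Beta.secondMoment (limKernelOf QA) μ ν + B12Beta.secondMoment (limKernelOf QB) μ ν := by
  have e : ∀ k x, QAB k μ ν x = 2 * P k μ ν x + QA k μ ν x + QB k μ ν x := fun k x => by
    have := hessianAtKernel_polarisation L a ha k (fun t => h0 t k) (fun t => hc0 t k) (h k) (hAB k) (hA k) (hB k) μ ν x
    linarith
  have sP : ∀ k, Summable fun x : Fin d → ℤ => P k μ ν x * (x μ : ℝ) * (x ν : ℝ) := fun k => hUP.summable hδP k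
  have sA : ∀ k, Summable fun x : Fin d → ℤ => QA k μ ν x * (x μ : ℝ) * (x ν : ℝ) := fun k => hUA.summable hδA k
  have sB : ∀ k, Summable fun x : Fin d → ℤ => QB k μ ν x * (x μ : ℝ) * (x ν : ℝ) := fun k => hUB.summable hδB k
  have s2P : ∀ k, Summable fun x : Fin d → ℤ => (2 * P k μ ν x) * (x μ : ℝ) * (x ν : ℝ) := fun k =>
    ((sP k).mul_left 2).congr fun x => by ring
  have s2PA : ∀ k, Summable fun x : Fin d → ℤ => (2 * P k μ ν x + QA k μ ν x) * (x μ : ℝ) * (x ν : ℝ) := fun k =>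
    (((sP k).mul_left 2).add (sA k)).congr fun x => by ring
  have hlev : ∀ k, B12Beta.secondMoment (QAB k) μ ν = 2 * B12Beta.secondMoment (P k) μ ν + B12Beta.secondMoment (QA k) μ ν + B12Beta.secondMoment (QB k) μ ν := by
    intro k
    rw [secondMoment_add_of_summable (R := QAB k) (P := fun μ' ν' x => 2 * P k μ' ν' x + QA k μ' ν' x) (Q := QB k) (fun x => e k x) (s2PA k) (sB k),
      secondMoment_add_of_summable (R := fun μ' ν' x => 2 * P k μ' ν' x + QA k μ' ν' x) (P := fun μ' ν' x => 2 * P k μ' ν' x) (Q := QA k) (fun x => rfl) (s2P k) (sA k),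
      secondMoment_const_mul 2 (P := P k) (R := fun μ' ν' x => 2 * P k μ' ν' x) (fun x => rfl)]
  refine ⟨hlev, fun hθ0 hθ1 hrP hrA hrB hrAB => ?_⟩
  exact tendsto_nhds_unique (tendsto_of_abs_sub_le_geometric hθ0 hθ1 hrAB)
    (((((tendsto_of_abs_sub_le_geometric hθ0 hθ1 hrP).const_mul 2).add (tendsto_of_abs_sub_le_geometric hθ0 hθ1 hrA)).add
      (tendsto_of_abs_sub_le_geometric hθ0 hθ1 hrB)).congr fun k => (hlev k).symm)

/-! ## §4 Over PART 269's END and leaf-01's `N = 2` END: displaying only `(α, β)` + EL₁ of `A, B` and the base data on the disc -/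

/-- **`exists_hessianAtMoments_polarisation_of_tendsto`** [our proof] (`d ≥ 3`, `L ≥ 2`, `a > 0`, `μ ≠ ν`, even cubic volumes): for volume-indexed REAL directions `A, B`
(`LipschitzBackground (α, β)` uniformly in `t`, EL₁) and a REAL base family `A₀` (`connV U₀,t` Lipschitz `(α₀, β₀)` with EL₁, `zT U₀,t` bounded `(α₀′, β₀′)` with EL₁) on the
three-condition disc at coupling `1`, PART 269 supplies limit kernels `Π` of the Hessian family of `(A, B)` at `U₀` and leaf-01's `conv_iteratedDeriv_invCov_expChartAt_of_tendsto` (at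
`N = 2`; the sum direction at `(2α, 2β)`) limit kernels `Π⁽²⁾_{A+B}, Π⁽²⁾_A, Π⁽²⁾_B`, all with (UD) at a positive exponent and the rate at `θ = √(L⁻¹)`; §3 then gives
`b⁽²⁾_k(A + B) = 2·b_k(A, B) + b⁽²⁾_k(A) + b⁽²⁾_k(B)` at every level AND at the limit — the off-diagonal β-type numbers at `U₀` from the one-parameter tower's numbers.
[cite: Balaban1985BackgroundPropagators, (3.3) p.390 (shapes); Balaban1987RG1, (1.20)–(1.22) p.264 (shapes)] -/
theorem exists_hessianAtMoments_polarisation_of_tendsto (hL : 2 ≤ L) (hd : 3 ≤ d) {μ ν : Fin d} (hne : μ ≠ ν) {α β α₀ β₀ α₀' β₀' a' κ : ℝ}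
    (ha' : 0 < a') (hκ0 : 0 < κ)
    (hγ' : Jfree d a' κ 1 < gammaPs d a') (hδ' : deltaK d a' κ 1 < sigma0 d a' ^ 2) (hJA : JA d a a' κ 1 < gamD d a)
    (hT₁ : 1 * (2 * (d * (α₀ + β₀) * Cst d a) + α₀' * Cst d a) ≤ 1 / 2)
    (hT₂ : 1 * (d * (α₀ * G2 d a (max (JA d a a' κ 1) 0) (gamD d a - max (JA d a a' κ 1) 0) κ)
      + d * (Real.exp |κ| * (α₀ * G2 d a (max (JA d a a' κ 1) 0) (gamD d a - max (JA d a a' κ 1) 0) κ + β₀ * (gamD d a - max (JA d a a' κ 1) 0)⁻¹))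
      + α₀' * (gamD d a - max (JA d a a' κ 1) 0)⁻¹) ≤ 1 / 2)
    (hT₃ : 4 * 1 * (2 * (d * (α₀ + β₀) * Cst d a) + α₀' * Cst d a) * Cst d a ≤ gammaB d a)
    {A₀ A B : (t : ℕ) → (k : ℕ) → Fin d → (idx L (cubic d (evenPeriod t)) k → ℝ)}
    (hA : ∀ t, LipschitzBackground L (cubic d (evenPeriod t)) (fun k ν' x => (A t k ν' x : ℂ)) α β)
    (hB : ∀ t, LipschitzBackground L (cubic d (evenPeriod t)) (fun k ν' x => (B t k ν' x : ℂ)) α β)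
    (hw : ∀ t, LipschitzBackground L (cubic d (evenPeriod t)) (connV L (cubic d (evenPeriod t)) (fun k'' ν' (x' : idx L (cubic d (evenPeriod t)) k'') => Complex.exp (Complex.I * ((A₀ t) k''
          ν' x' : ℂ) / ((lev L k'' : ℕ) : ℂ)))) α₀ β₀)
    (hz : ∀ t, BoundedBackground L (cubic d (evenPeriod t)) (zT L (cubic d (evenPeriod t)) (fun k'' ν' (x' : idx L (cubic d (evenPeriod t)) k'') => Complex.exp (Complex.I * ((A₀ t) k'' ν'
          x' : ℂ) / ((lev L k'' : ℕ) : ℂ)))) α₀' β₀')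
    (hA1 : ∀ k (ν' f : Fin d) (z : Fin d → ℤ), ∃ s' : ℂ, Tendsto (fun t => ((A t k ν' (castT (cubic d (lev L k * evenPeriod t)) z, f) : ℝ) : ℂ)) atTop (𝓝 s'))
    (hB1 : ∀ k (ν' f : Fin d) (z : Fin d → ℤ), ∃ s' : ℂ, Tendsto (fun t => ((B t k ν' (castT (cubic d (lev L k * evenPeriod t)) z, f) : ℝ) : ℂ)) atTop (𝓝 s'))
    (hw1 : ∀ k (ν' f : Fin d) (z : Fin d → ℤ), ∃ s' : ℂ, Tendsto (fun t => connV L (cubic d (evenPeriod t)) (fun k'' ν' (x' : idx L (cubic d (evenPeriod t)) k'') => Complex.exp (Complex.I *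
          ((A₀ t) k'' ν' x' : ℂ) / ((lev L k'' : ℕ) : ℂ))) k ν' (castT (cubic d (lev L k * evenPeriod t)) z, f)) atTop (𝓝 s'))
    (hz1 : ∀ k (f : Fin d) (z : Fin d → ℤ), ∃ s' : ℂ, Tendsto (fun t => zT L (cubic d (evenPeriod t)) (fun k'' ν' (x' : idx L (cubic d (evenPeriod t)) k'') => Complex.exp (Complex.I * ((A₀
          t) k'' ν' x' : ℂ) / ((lev L k'' : ℕ) : ℂ))) k (castT (cubic d (lev L k * evenPeriod t)) z, f)) atTop (𝓝 s')) :
    ∃ P QAB QA QB : ℕ → B12Beta.Kernel d,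
      (∀ k, IsInfiniteVolumeLimit evenPeriod
      (fun t μ' ν' (z : Site d (evenPeriod t)) =>
          ((deriv (fun r : ℝ => deriv (fun s : ℝ => (avgTow (QBlev L (cubic d (evenPeriod t))) ((L : ℝ) ^ d)
          (fun k' => (calDalev L (cubic d (evenPeriod t)) a ha k' + covPert L (cubic d (evenPeriod t)) (fun k'' ν' (x' : idx L (cubic d (evenPeriod t)) k'') => Complex.exp
                (Complex.I * ((A₀ t) k'' ν' x' : ℂ) / ((lev L k'' : ℕ) : ℂ) + (Complex.I * ((A t) k'' ν' x' : ℂ) / ((lev L k'' : ℕ) : ℂ)) * ((s : ℝ) : ℂ) + (Complex.I * ((B t) k'' ν' x' :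
                      ℂ) / ((lev L k'' : ℕ) : ℂ)) * ((r : ℝ) :
                ℂ))) k')⁻¹) k)⁻¹) 0) 0)
            ((unitIdx L (cubic d (evenPeriod t))).symm (z, μ')) ((unitIdx L (cubic d (evenPeriod t))).symm (0, ν'))).re) (P k)) ∧
      (∀ k, IsInfiniteVolumeLimit evenPeriod
      (fun t μ' ν' (z : Site d (evenPeriod t)) =>
          ((iteratedDeriv 2 (fun s : ℝ => (avgTow (QBlev L (cubic d (evenPeriod t))) ((L : ℝ) ^ d)
          (fun k' => (calDalev L (cubic d (evenPeriod t)) a ha k' + covPert L (cubic d (evenPeriod t)) (fun k'' ν' (x' : idx L (cubic d (evenPeriod t)) k'') => Complex.exp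
                (Complex.I * ((A₀ t) k'' ν' x' : ℂ) / ((lev L k'' : ℕ) : ℂ) + (Complex.I * ((A t k'' ν' x' + B t k'' ν' x' : ℝ) : ℂ) / ((lev L k'' : ℕ) : ℂ)) * ((s : ℝ) : ℂ))) k')⁻¹) k)⁻¹)
                      0)
            ((unitIdx L (cubic d (evenPeriod t))).symm (z, μ')) ((unitIdx L (cubic d (evenPeriod t))).symm (0, ν'))).re) (QAB k)) ∧
      (∀ k, IsInfiniteVolumeLimit evenPeriod
      (fun t μ' ν' (z : Site d (evenPeriod t)) =>
          ((iteratedDeriv 2 (fun s : ℝ => (avgTow (QBlev L (cubic d (evenPeriod t))) ((L : ℝ) ^ d)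
          (fun k' => (calDalev L (cubic d (evenPeriod t)) a ha k' + covPert L (cubic d (evenPeriod t)) (fun k'' ν' (x' : idx L (cubic d (evenPeriod t)) k'') => Complex.exp
                (Complex.I * ((A₀ t) k'' ν' x' : ℂ) / ((lev L k'' : ℕ) : ℂ) + (Complex.I * ((A t) k'' ν' x' : ℂ) / ((lev L k'' : ℕ) : ℂ)) * ((s : ℝ) : ℂ))) k')⁻¹) k)⁻¹) 0)
            ((unitIdx L (cubic d (evenPeriod t))).symm (z, μ')) ((unitIdx L (cubic d (evenPeriod t))).symm (0, ν'))).re) (QA k)) ∧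
      (∀ k, IsInfiniteVolumeLimit evenPeriod
      (fun t μ' ν' (z : Site d (evenPeriod t)) =>
          ((iteratedDeriv 2 (fun s : ℝ => (avgTow (QBlev L (cubic d (evenPeriod t))) ((L : ℝ) ^ d)
          (fun k' => (calDalev L (cubic d (evenPeriod t)) a ha k' + covPert L (cubic d (evenPeriod t)) (fun k'' ν' (x' : idx L (cubic d (evenPeriod t)) k'') => Complex.exp
                (Complex.I * ((A₀ t) k'' ν' x' : ℂ) / ((lev L k'' : ℕ) : ℂ) + (Complex.I * ((B t) k'' ν' x' : ℂ) / ((lev L k'' : ℕ) : ℂ)) * ((s : ℝ) : ℂ))) k')⁻¹) k)⁻¹) 0)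
            ((unitIdx L (cubic d (evenPeriod t))).symm (z, μ')) ((unitIdx L (cubic d (evenPeriod t))).symm (0, ν'))).re) (QB k)) ∧
      (∀ k, B12Beta.secondMoment (QAB k) μ ν = 2 * B12Beta.secondMoment (P k) μ ν + B12Beta.secondMoment (QA k) μ ν + B12Beta.secondMoment (QB k) μ ν) ∧
      B12Beta.secondMoment (limKernelOf QAB) μ ν
        = 2 * B12Beta.secondMoment (limKernelOf P) μ ν + B12Beta.secondMoment (limKernelOf QA) μ ν + B12Beta.secondMoment (limKernelOf QB) μ ν := by
  have hα : 0 ≤ α := (hA 0).nonneg.1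
  have hβ : 0 ≤ β := (hA 0).nonneg.2
  have hd1 : 1 ≤ d := le_trans (by norm_num) hd
  have hd0 : (0 : ℝ) < d := by exact_mod_cast (lt_of_lt_of_le (by norm_num) hd : 0 < d)
  have hL1 : (1 : ℝ) < L := by exact_mod_cast (lt_of_lt_of_le one_lt_two hL : 1 < L)
  have hθ0 : 0 ≤ Real.sqrt ((L : ℝ)⁻¹) := Real.sqrt_nonneg _
  have hθ1 : Real.sqrt ((L : ℝ)⁻¹) < 1 := by
    rw [show (1 : ℝ) = Real.sqrt 1 from Real.sqrt_one.symm]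
    exact Real.sqrt_lt_sqrt (inv_nonneg.mpr (Nat.cast_nonneg _)) (inv_lt_one_of_one_lt₀ hL1)
  -- invertibility at the base, every volume and level (PART 271 §0 on the disc)
  have h0 := fun t k => isUnit_det_calDalev_add_covPert_of_disc L (cubic d (evenPeriod t)) a ha hd1 (hw t) (hz t) hT₁ k
  have hc0 := fun t k => isUnit_det_avgTow_pertInv_of_disc L (cubic d (evenPeriod t)) a ha hd1 (hw t) (hz t) hT₁ hT₃ k
  -- the sum direction: Lipschitz `(2α, 2β)`, EL₁
  have hS : ∀ t, LipschitzBackground L (cubic d (evenPeriod t)) (fun k ν' x => ((A t k ν' x + B t k ν' x : ℝ) : ℂ)) (α + α) (β + β) := fun t => by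
    have e : (fun k ν' (x : idx L (cubic d (evenPeriod t)) k) => ((A t k ν' x + B t k ν' x : ℝ) : ℂ))
        = fun k ν' x => (A t k ν' x : ℂ) + (B t k ν' x : ℂ) := by
      funext k ν' x
      push_cast
      rfl
    rw [e]
    exact lipschitzBackground_add L _ (hA t) (hB t)
  have hS1 : ∀ k (ν' f : Fin d) (z : Fin d → ℤ), ∃ s' : ℂ,
      Tendsto (fun t => ((A t k ν' (castT (cubic d (lev L k * evenPeriod t)) z, f) + B t k ν' (castT (cubic d (lev L k * evenPeriod t)) z, f) : ℝ) : ℂ)) atTop (𝓝 s') := by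
    intro k ν' f z
    obtain ⟨s₁, h₁⟩ := hA1 k ν' f z
    obtain ⟨s₂, h₂⟩ := hB1 k ν' f z
    exact ⟨s₁ + s₂, (h₁.add h₂).congr fun t => (Complex.ofReal_add _ _).symm⟩
  obtain ⟨κ₁, C₁, C₁', hκ₁, -, -, P, hI, hU, -, -, hr⟩ :=
    conv_deriv_deriv_invCov_expChartAt₂_of_tendsto L a ha hL hd hne ha' hκ0 hγ' hδ' hJA hT₁ hT₂ hT₃ hA hB hw hz hA1 hB1 hw1 hz1
  obtain ⟨κ₂, C₂, C₂', hκ₂, -, -, QA, hIA, hUA, -, -, hrA⟩ :=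
    conv_iteratedDeriv_invCov_expChartAt_of_tendsto L a ha hL hd hne ha' hκ0 hγ' hδ' hJA hT₁ hT₂ hT₃ 2 hA hw hz hA1 hw1
  obtain ⟨κ₃, C₃, C₃', hκ₃, -, -, QB, hIB, hUB, -, -, hrB⟩ :=
    conv_iteratedDeriv_invCov_expChartAt_of_tendsto L a ha hL hd hne ha' hκ0 hγ' hδ' hJA hT₁ hT₂ hT₃ 2 hB hw hz hB1 hw1
  obtain ⟨κ₄, C₄, C₄', hκ₄, -, -, QAB, hIAB, -, -, -, hrAB⟩ :=
    conv_iteratedDeriv_invCov_expChartAt_of_tendsto L a ha hL hd hne ha' hκ0 hγ' hδ' hJA hT₁ hT₂ hT₃ 2 hS hw hz hS1 hw1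
  have hpol := hessianAtMoments_polarisation L a ha h0 hc0 hI hIAB hIA hIB hU (div_pos hκ₁ hd0) hUA (div_pos hκ₂ hd0) hUB (div_pos hκ₃ hd0)
  exact ⟨P, QAB, QA, QB, hI, hIAB, hIA, hIB, hpol.1, hpol.2 hθ0 hθ1 hr hrA hrB hrAB⟩

end Kernels

end Summit.QuantumFields.BalabanUV.Beta.GAN24.ExponentialChartBasePolarisation

end
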